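import Mathlib
import Summits.KontsevichZagierPeriods.KontsevichZagierPeriods.Theses.DefinableMoves
import Literature.NumberTheory.Transcendental.SemialgebraicAlgebraicPoints
import Literature.NumberTheory.Transcendental.LindemannWeierstrassProofs
import Summits.KontsevichZagierPeriods.KontsevichZagierPeriods.Theorems.DefinableMovesCircleSquaringImpossibleToolkit
import Summits.KontsevichZagierPeriods.KontsevichZagierPeriods.Theorems.DefinableMovesCircleSquaringImpossibleValid
import Summits.KontsevichZagierPeriods.KontsevichZagierPeriods.Theorems.DefinableMovesCircleSquaringImpossibleTransport
import Summits.KontsevichZagierPeriods.KontsevichZagierPeriods.Theorems.DefinableMovesCircleSquaringImpossibleDefinable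

/-!
# `CircleSquaringImpossible` (item stmt-KontsevichZagierPeriods-5830, route DefinableMoves)

**Algebraic scissors cannot square the circle.** For no `M` is there an `ℝ`-semialgebraic `s` of
full measure in `D × [0,1]^M` (`D` the open unit disc) and an `ℝ`-semialgebraic `Φ`, injective on
`s`, differentiable within `s` with `|det Φ'| = 1`, whose image is a full-measure subset of
`(0,π) × (0,1) × [0,1]^M`.

Proof (parameter-free definability / Tarski transfer, as planned by the route):
1. (`…Toolkit`) the graph of `Φ` over `s`, an `ℝ`-semialgebraic set, is the fibre at a real
   parameter `c₀ ∈ ℝ^γ` of a `ℚ`-semialgebraic family `G ⊆ ℝ^(γ ⊕ (n ⊕ n))`;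
2. (`…Valid`) "`G_c` is the graph of such a transport onto the box-cylinder of LENGTH `λ`" is
   implied by a condition `Valid(λ, c)`, first-order over `(ℝ,+,·,<)` WITHOUT parameters in
   `(λ, c)`, which holds at `(π, c₀)` (`valid_of_transport`);
3. (`…Transport`) conversely `Valid(λ, c)` forces `λ = π`, by the change of
   variables formula (`|det Φ'| = 1` ⟹ volume preserving) and `vol (D × [0,1]^M) = π`,
   `vol ((0,λ) × (0,1) × [0,1]^M) = max(λ,0)`;
4. (`…Definable`) hence `Λ := {λ | ∃ c, Valid(λ, c)}` is `ℚ`-semialgebraic (Tarski–Seidenberg),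
   and `Λ = {π}` by 2–3; but a point of a finite `ℚ`-semialgebraic subset of the line is algebraic
   (tree `isAlgebraic_of_mem_of_finite`), contradicting Lindemann's theorem
   (tree `transcendental_pi_holds`).
-/

noncomputable section

open Set MeasureTheory Sum

namespace Summit.KontsevichZagierPeriods.DefinableMoves.CircleSquaring

open Literature.ModelTheory.ExponentialFields Literature.NumberTheory.Transcendental

/-- Reindexing a graph `{Fin.append x (Φ x) | x ∈ s} ⊆ ℝ^(n+n)` to `ℝ^(n ⊕ n)`:
`Sum.elim x y ∘ finSumFinEquiv.symm = Fin.append x y`. [folklore] -/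
theorem sumElim_comp_finSumFinEquiv_symm {n : ℕ} (x y : Fin n → ℝ) :
    (Sum.elim x y ∘ ⇑(finSumFinEquiv (m := n) (n := n)).symm) = Fin.append x y := by
  funext z
  refine Fin.addCases (fun i => ?_) (fun j => ?_) z
  · simp only [Function.comp_apply, finSumFinEquiv_symm_apply_castAdd, Sum.elim_inl,
      Fin.append_left]
  · simp only [Function.comp_apply, finSumFinEquiv_symm_apply_natAdd, Sum.elim_inr,
      Fin.append_right]

/-- **Algebraic scissors cannot square the circle** — item stmt-KontsevichZagierPeriods-5830 of
route DefinableMoves: there is no `ℝ`-semialgebraic volume-preserving (`|det Φ'| = 1`) stable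
a.e.-transport from the disc-cylinder `D × [0,1]^M` onto the box-cylinder
`(0,π) × (0,1) × [0,1]^M`, by parameter-free definability of the transport condition in the length
of the box, volume preservation, and the transcendence of `π`. [folklore] -/
theorem circleSquaringImpossible_proof :
    Summit.KontsevichZagierPeriods.KontsevichZagierPeriods.Theses.DefinableMoves.CircleSquaringImpossible := by
  unfold Summit.KontsevichZagierPeriods.KontsevichZagierPeriods.Theses.DefinableMoves.CircleSquaringImpossible
  rintro ⟨M, s, Φ, Φ', h1, h2, h3, h4, h5, h6, h7, h8, h9⟩
  -- 1. the graph, reindexed to `ℝ^(n ⊕ n)`, is a fibre of a `ℚ`-semialgebraic family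
  have hG₀ : IsSemialgebraic ℝ ((fun t : Fin (2 + M) ⊕ Fin (2 + M) → ℝ =>
      t ∘ ⇑(finSumFinEquiv (m := 2 + M) (n := 2 + M)).symm) ⁻¹'
        {z : Fin ((2 + M) + (2 + M)) → ℝ | ∃ x ∈ s, z = Fin.append x (Φ x)}) :=
    h6.preimage_comp _
  obtain ⟨γ, _, c₀, G, hG, hmem⟩ := hG₀.exists_rat_family
  have hrel : ∀ x y, Sum.elim c₀ (Sum.elim x y) ∈ G ↔ x ∈ s ∧ y = Φ x := by
    intro x y
    rw [← hmem, mem_preimage, sumElim_comp_finSumFinEquiv_symm, mem_setOf_eq]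
    constructor
    · rintro ⟨x', hx', heq⟩
      have hx : x = x' := by
        funext i
        have := congr_fun heq (Fin.castAdd (2 + M) i)
        simpa only [Fin.append_left] using this
      have hy : y = Φ x' := by
        funext j
        have := congr_fun heq (Fin.natAdd (2 + M) j)
        simpa only [Fin.append_right] using this
      subst hx
      exact ⟨hx', hy⟩
    · rintro ⟨hx, rfl⟩
      exact ⟨x, hx, rfl⟩
  -- 2. the transport condition holds at `(π, c₀)`
  have hValid : ((∀ x y y' : Fin (2 + M) → ℝ, Sum.elim c₀ (Sum.elim x y) ∈ G → Sum.elim c₀ (Sum.elim x y') ∈ G →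
        ∀ i, y i = y' i)) ∧
        ((∀ x y : Fin (2 + M) → ℝ, Sum.elim c₀ (Sum.elim x y) ∈ G → x ∈ {z : Fin (2 + M) → ℝ | z (Fin.castAdd M 0) ^ 2 + z (Fin.castAdd M 1) ^ 2 < 1 ∧
              ∀ j : Fin M, z (Fin.natAdd 2 j) ∈ Set.Icc (0:ℝ) 1})) ∧
        ((∀ x : Fin (2 + M) → ℝ, ∀ r : Fin 1 → ℝ, 0 < r 0 →
              ∃ x' : Fin (2 + M) → ℝ, (∀ i, (x' i - x i) ^ 2 < r 0) ∧
                (x' ∈ {z : Fin (2 + M) → ℝ | z (Fin.castAdd M 0) ^ 2 + z (Fin.castAdd M 1) ^ 2 < 1 ∧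
                      ∀ j : Fin M, z (Fin.natAdd 2 j) ∈ Set.Icc (0:ℝ) 1} → ∃ y : Fin (2 + M) → ℝ, Sum.elim c₀ (Sum.elim x' y) ∈ G))) ∧
        ((∀ x y : Fin (2 + M) → ℝ, Sum.elim c₀ (Sum.elim x y) ∈ G → y ∈ {z : Fin (2 + M) → ℝ | z (Fin.castAdd M 0) ∈ Set.Ioo 0 Real.pi ∧ z (Fin.castAdd M 1) ∈ Set.Ioo (0:ℝ) 1 ∧
              ∀ j : Fin M, z (Fin.natAdd 2 j) ∈ Set.Icc (0:ℝ) 1})) ∧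
        ((∀ y : Fin (2 + M) → ℝ, ∀ r : Fin 1 → ℝ, 0 < r 0 →
              ∃ y' : Fin (2 + M) → ℝ, (∀ i, (y' i - y i) ^ 2 < r 0) ∧
                (y' ∈ {z : Fin (2 + M) → ℝ | z (Fin.castAdd M 0) ∈ Set.Ioo 0 Real.pi ∧ z (Fin.castAdd M 1) ∈ Set.Ioo (0:ℝ) 1 ∧
                      ∀ j : Fin M, z (Fin.natAdd 2 j) ∈ Set.Icc (0:ℝ) 1} → ∃ x : Fin (2 + M) → ℝ, Sum.elim c₀ (Sum.elim x y') ∈ G))) ∧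
        ((∀ x x' y : Fin (2 + M) → ℝ, Sum.elim c₀ (Sum.elim x y) ∈ G → Sum.elim c₀ (Sum.elim x' y) ∈ G →
              ∀ i, x i = x' i)) ∧
        ((∀ x y₀ : Fin (2 + M) → ℝ, Sum.elim c₀ (Sum.elim x y₀) ∈ G →
              ∃ L : Fin (2 + M) × Fin (2 + M) → ℝ, (Matrix.of fun i j => L (i, j)).det ^ 2 = 1 ∧
                ∀ e : Fin 1 → ℝ, 0 < e 0 → ∃ d : Fin 1 → ℝ, 0 < d 0 ∧
                  ∀ x' y : Fin (2 + M) → ℝ, Sum.elim c₀ (Sum.elim x' y) ∈ G →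
                    (∀ i, (x' i - x i) ^ 2 < d 0) →
                      ∀ i, ∃ j, (y i - y₀ i - ∑ k, L (i, k) * (x' k - x k)) ^ 2 ≤ e 0 * (x' j - x j) ^ 2)) := valid_of_transport hrel h1 h2 h3 h4 h7 h8 h9
  -- 4. `Λ = {λ | ∃ c, Valid(λ, c)}` is `ℚ`-semialgebraic …
  set Λ : Set (Fin 1 → ℝ) := {u | ∃ v : γ → ℝ, Sum.elim u v ∈
    {w : Fin 1 ⊕ γ → ℝ | ((∀ x y y' : Fin (2 + M) → ℝ, Sum.elim (fun g => w (inr g)) (Sum.elim x y) ∈ G → Sum.elim (fun g => w (inr g)) (Sum.elim x y') ∈ G →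
          ∀ i, y i = y' i)) ∧
          ((∀ x y : Fin (2 + M) → ℝ, Sum.elim (fun g => w (inr g)) (Sum.elim x y) ∈ G → x ∈ {z : Fin (2 + M) → ℝ | z (Fin.castAdd M 0) ^ 2 + z (Fin.castAdd M 1) ^ 2 < 1 ∧
                ∀ j : Fin M, z (Fin.natAdd 2 j) ∈ Set.Icc (0:ℝ) 1})) ∧
          ((∀ x : Fin (2 + M) → ℝ, ∀ r : Fin 1 → ℝ, 0 < r 0 →
                ∃ x' : Fin (2 + M) → ℝ, (∀ i, (x' i - x i) ^ 2 < r 0) ∧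
                  (x' ∈ {z : Fin (2 + M) → ℝ | z (Fin.castAdd M 0) ^ 2 + z (Fin.castAdd M 1) ^ 2 < 1 ∧
                        ∀ j : Fin M, z (Fin.natAdd 2 j) ∈ Set.Icc (0:ℝ) 1} → ∃ y : Fin (2 + M) → ℝ, Sum.elim (fun g => w (inr g)) (Sum.elim x' y) ∈ G))) ∧
          ((∀ x y : Fin (2 + M) → ℝ, Sum.elim (fun g => w (inr g)) (Sum.elim x y) ∈ G → y ∈ {z : Fin (2 + M) → ℝ | z (Fin.castAdd M 0) ∈ Set.Ioo 0 (w (inl 0)) ∧ z (Fin.castAdd M 1) ∈ Set.Ioo (0:ℝ) 1 ∧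
                ∀ j : Fin M, z (Fin.natAdd 2 j) ∈ Set.Icc (0:ℝ) 1})) ∧
          ((∀ y : Fin (2 + M) → ℝ, ∀ r : Fin 1 → ℝ, 0 < r 0 →
                ∃ y' : Fin (2 + M) → ℝ, (∀ i, (y' i - y i) ^ 2 < r 0) ∧
                  (y' ∈ {z : Fin (2 + M) → ℝ | z (Fin.castAdd M 0) ∈ Set.Ioo 0 (w (inl 0)) ∧ z (Fin.castAdd M 1) ∈ Set.Ioo (0:ℝ) 1 ∧
                        ∀ j : Fin M, z (Fin.natAdd 2 j) ∈ Set.Icc (0:ℝ) 1} → ∃ x : Fin (2 + M) → ℝ, Sum.elim (fun g => w (inr g)) (Sum.elim x y') ∈ G))) ∧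
          ((∀ x x' y : Fin (2 + M) → ℝ, Sum.elim (fun g => w (inr g)) (Sum.elim x y) ∈ G → Sum.elim (fun g => w (inr g)) (Sum.elim x' y) ∈ G →
                ∀ i, x i = x' i)) ∧
          ((∀ x y₀ : Fin (2 + M) → ℝ, Sum.elim (fun g => w (inr g)) (Sum.elim x y₀) ∈ G →
                ∃ L : Fin (2 + M) × Fin (2 + M) → ℝ, (Matrix.of fun i j => L (i, j)).det ^ 2 = 1 ∧
                  ∀ e : Fin 1 → ℝ, 0 < e 0 → ∃ d : Fin 1 → ℝ, 0 < d 0 ∧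
                    ∀ x' y : Fin (2 + M) → ℝ, Sum.elim (fun g => w (inr g)) (Sum.elim x' y) ∈ G →
                      (∀ i, (x' i - x i) ^ 2 < d 0) →
                        ∀ i, ∃ j, (y i - y₀ i - ∑ k, L (i, k) * (x' k - x k)) ^ 2 ≤ e 0 * (x' j - x j) ^ 2))}} with hΛdef
  have hΛ : IsSemialgebraic ℚ Λ := (isSemialgebraic_setOf_valid hG).exists_sum
  -- 3. … and consists of `π` alone
  have hsub : Λ ⊆ {fun _ => Real.pi} := by
    rintro u ⟨v, hv⟩
    have hu : u 0 = Real.pi := eq_pi_of_valid hG hv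
    rw [mem_singleton_iff]
    funext i
    rw [Subsingleton.elim i 0, hu]
  have hfin : Λ.Finite := (finite_singleton _).subset hsub
  have hmemΛ : (fun _ => Real.pi : Fin 1 → ℝ) ∈ Λ := ⟨c₀, hValid⟩
  -- hence `π` is algebraic: contradiction with Lindemann
  have halg : IsAlgebraic ℚ Real.pi := isAlgebraic_of_mem_of_finite hΛ hfin hmemΛ
  exact transcendental_pi_holds halg

end Summit.KontsevichZagierPeriods.DefinableMoves.CircleSquaring
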